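import Literature.Analysis.UnboundedOperators.HilleYosidaGenerator
import HarnessLib

/-!
# The Lumer–Phillips form of the generation theorem: an m-dissipative operator generates a contraction
  C₀-semigroup (Engel–Nagel II Thm. 3.15), via the Hille–Yosida theorem of `HilleYosidaGenerator.lean`

Analysis/UnboundedOperators support file (one `structure` of hypotheses, two definitions with bodies,
everything proved, no named facts). The Hille–Yosida files take the RESOLVENT as the primary object (a
pseudo-resolvent `J`). Operators usually arrive as partially defined linear maps `A : E →ₗ.[ℂ] E`
(Mathlib's `LinearPMap`; e.g. the generator of a semigroup, a closed-form operator, a differential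
operator on its domain). Engel–Nagel (2000), Ch. II Thm. 3.15 (Lumer–Phillips): a densely defined
DISSIPATIVE operator (`‖(λ − A)x‖ ≥ λ‖x‖` for `λ > 0`, Prop. II.3.14 / Def. 3.13) with `λ − A` SURJECTIVE
for (one, equivalently all) `λ > 0` generates a contraction semigroup. This file:

* `IsLumerPhillipsData A` — dense domain, dissipativity for all real `λ > 0`, surjectivity of `λ − A`
  for all `λ > 0` (the "m-dissipative" hypotheses);
* `lpResolvent h hl : E →L[ℂ] E` — the bounded inverse `(λ − A)⁻¹`, `‖(λ − A)⁻¹‖ ≤ 1/λ`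
  (`norm_lpResolvent_le`), with `(λ − A)(λ − A)⁻¹ = 1` (`sub_apply_lpResolvent`) and
  `(λ − A)⁻¹(λ − A) = 1_{D(A)}` (`lpResolvent_sub_apply`);
* `lpFamily h : ℂ → E →L[ℂ] E` — the family `z ↦ (Re z − A)⁻¹` on the positive real axis
  `U = {Im z = 0, Re z > 0}` (junk `0` elsewhere), a pseudo-resolvent there (`isPseudoResolvent_lpFamily`)
  and Hille–Yosida data (`isHilleYosidaData_lpFamily`);
* **`exists_c0Semigroup`** — there is a contraction C₀-semigroup `T` with `T.generator = A` (and
  Laplace transform `(λ − A)⁻¹` at real `λ > 0`); by `C0Semigroup.eq_of_generator_eq` it is unique.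

## References

* K.-J. Engel, R. Nagel, *One-Parameter Semigroups for Linear Evolution Equations* (2000),
  Ch. II Def. 3.13, Prop. 3.14, Thm. 3.15 (Lumer–Phillips). [EngelNagel2000]
* G. Lumer, R. S. Phillips, Pacific J. Math. 11 (1961) 679–698.
-/

noncomputable section

open NormedSpace Filter Set Metric Literature.Analysis.OperatorTheory
open scoped Topology NNReal

namespace Literature.Analysis.UnboundedOperators

namespace HilleYosida

variable {E : Type*} [NormedAddCommGroup E] [NormedSpace ℂ E] [CompleteSpace E]

/-- **m-dissipative data (Lumer–Phillips hypotheses)** for a partially defined operator `A`: dense domain,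
dissipativity `λ‖x‖ ≤ ‖λx − Ax‖` for real `λ > 0`, and surjectivity of `λ − A` for real `λ > 0`.
[cite: EngelNagel2000, Ch. II Thm. 3.15] -/
structure IsLumerPhillipsData (A : E →ₗ.[ℂ] E) : Prop where
  /-- `D(A)` is dense -/
  dense : Dense (A.domain : Set E)
  /-- dissipativity: `λ‖x‖ ≤ ‖λx − Ax‖` for `λ > 0`, `x ∈ D(A)` -/
  dissipative : ∀ l : ℝ, 0 < l → ∀ x : A.domain, l * ‖(x : E)‖ ≤ ‖(l : ℂ) • (x : E) - A x‖
  /-- range condition: `λ − A` is onto for `λ > 0` -/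
  surj : ∀ l : ℝ, 0 < l → ∀ y : E, ∃ x : A.domain, (l : ℂ) • (x : E) - A x = y

namespace IsLumerPhillipsData

variable {A : E →ₗ.[ℂ] E}

/-! ### The operator `λ − A : D(A) → E` and its bounded inverse -/

/-- `λ − A` as a linear map `D(A) → E`. [cite: EngelNagel2000, Ch. II Def. 3.13] -/
def subMap (A : E →ₗ.[ℂ] E) (l : ℝ) : A.domain →ₗ[ℂ] E := (l : ℂ) • A.domain.subtype - A.toFun

omit [CompleteSpace E] in
/-- `subMap A λ x = λx − Ax`. [cite: EngelNagel2000, Ch. II Def. 3.13] -/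
theorem subMap_apply (A : E →ₗ.[ℂ] E) (l : ℝ) (x : A.domain) : subMap A l x = (l : ℂ) • (x : E) - A x := rfl

omit [CompleteSpace E] in
/-- Dissipativity makes `λ − A` injective (`λ > 0`). [cite: EngelNagel2000, Ch. II Prop. 3.14] -/
theorem injective_subMap (h : IsLumerPhillipsData A) {l : ℝ} (hl : 0 < l) : Function.Injective (subMap A l) := by
  refine (injective_iff_map_eq_zero _).2 fun x hx => ?_
  have hd := h.dissipative l hl x
  rw [← subMap_apply, hx, norm_zero] at hd
  have hx0 : ‖(x : E)‖ = 0 := le_antisymm (by nlinarith [norm_nonneg (x : E)]) (norm_nonneg _)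
  exact Subtype.ext (norm_eq_zero.1 hx0)

omit [CompleteSpace E] in
/-- `λ − A : D(A) → E` is bijective (`λ > 0`). [cite: EngelNagel2000, Ch. II Thm. 3.15] -/
theorem bijective_subMap (h : IsLumerPhillipsData A) {l : ℝ} (hl : 0 < l) : Function.Bijective (subMap A l) :=
  ⟨h.injective_subMap hl, fun y => by obtain ⟨x, hx⟩ := h.surj l hl y; exact ⟨x, hx⟩⟩

/-- The linear inverse `(λ − A)⁻¹ : E → D(A) ⊆ E`. [cite: EngelNagel2000, Ch. II Thm. 3.15] -/
def lpResolventLM (h : IsLumerPhillipsData A) {l : ℝ} (hl : 0 < l) : E →ₗ[ℂ] E :=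
  A.domain.subtype.comp (LinearEquiv.ofBijective (subMap A l) (h.bijective_subMap hl)).symm.toLinearMap

omit [CompleteSpace E] in
/-- `(λ − A)⁻¹ y ∈ D(A)`. [cite: EngelNagel2000, Ch. II Thm. 3.15] -/
theorem lpResolventLM_mem (h : IsLumerPhillipsData A) {l : ℝ} (hl : 0 < l) (y : E) : h.lpResolventLM hl y ∈ A.domain :=
  ((LinearEquiv.ofBijective (subMap A l) (h.bijective_subMap hl)).symm y).2

omit [CompleteSpace E] in
/-- `(λ − A)((λ − A)⁻¹ y) = y`. [cite: EngelNagel2000, Ch. II Thm. 3.15] -/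
theorem subMap_lpResolventLM (h : IsLumerPhillipsData A) {l : ℝ} (hl : 0 < l) (y : E) :
    subMap A l ⟨h.lpResolventLM hl y, h.lpResolventLM_mem hl y⟩ = y := by
  have h1 := (LinearEquiv.ofBijective (subMap A l) (h.bijective_subMap hl)).apply_symm_apply y
  rw [LinearEquiv.ofBijective_apply] at h1
  exact h1

omit [CompleteSpace E] in
/-- `(λ − A)⁻¹((λ − A) x) = x` for `x ∈ D(A)`. [cite: EngelNagel2000, Ch. II Thm. 3.15] -/
theorem lpResolventLM_subMap (h : IsLumerPhillipsData A) {l : ℝ} (hl : 0 < l) (x : A.domain) :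
    h.lpResolventLM hl (subMap A l x) = x := by
  have h1 := (LinearEquiv.ofBijective (subMap A l) (h.bijective_subMap hl)).symm_apply_apply x
  rw [LinearEquiv.ofBijective_apply] at h1
  show ((LinearEquiv.ofBijective (subMap A l) (h.bijective_subMap hl)).symm (subMap A l x) : E) = x
  rw [h1]

omit [CompleteSpace E] in
/-- **`‖(λ − A)⁻¹ y‖ ≤ ‖y‖/λ`** (dissipativity). [cite: EngelNagel2000, Ch. II Prop. 3.14] -/
theorem norm_lpResolventLM_le (h : IsLumerPhillipsData A) {l : ℝ} (hl : 0 < l) (y : E) : ‖h.lpResolventLM hl y‖ ≤ l⁻¹ * ‖y‖ := by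
  have hd := h.dissipative l hl ⟨h.lpResolventLM hl y, h.lpResolventLM_mem hl y⟩
  rw [← subMap_apply, h.subMap_lpResolventLM hl y] at hd
  rw [inv_mul_eq_div, le_div_iff₀ hl, mul_comm]
  exact hd

/-- **The resolvent `(λ − A)⁻¹` as a bounded operator** (`λ > 0`). [cite: EngelNagel2000, Ch. II Thm. 3.15] -/
def lpResolvent (h : IsLumerPhillipsData A) {l : ℝ} (hl : 0 < l) : E →L[ℂ] E :=
  LinearMap.mkContinuous (h.lpResolventLM hl) l⁻¹ (h.norm_lpResolventLM_le hl)

omit [CompleteSpace E] in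
/-- `lpResolvent` acts as `lpResolventLM`. [cite: EngelNagel2000, Ch. II Thm. 3.15] -/
theorem lpResolvent_apply (h : IsLumerPhillipsData A) {l : ℝ} (hl : 0 < l) (y : E) : h.lpResolvent hl y = h.lpResolventLM hl y := rfl

omit [CompleteSpace E] in
/-- `‖(λ − A)⁻¹‖ ≤ 1/λ`. [cite: EngelNagel2000, Ch. II Thm. 3.15] -/
theorem norm_lpResolvent_le (h : IsLumerPhillipsData A) {l : ℝ} (hl : 0 < l) : ‖h.lpResolvent hl‖ ≤ l⁻¹ :=
  LinearMap.mkContinuous_norm_le _ (inv_nonneg.2 hl.le) _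

omit [CompleteSpace E] in
/-- `(λ − A)⁻¹ y ∈ D(A)` and `λ(λ − A)⁻¹y − A((λ − A)⁻¹y) = y`. [cite: EngelNagel2000, Ch. II Thm. 3.15] -/
theorem sub_apply_lpResolvent (h : IsLumerPhillipsData A) {l : ℝ} (hl : 0 < l) (y : E) :
    ∃ hy : h.lpResolvent hl y ∈ A.domain, (l : ℂ) • h.lpResolvent hl y - A ⟨h.lpResolvent hl y, hy⟩ = y :=
  ⟨h.lpResolventLM_mem hl y, h.subMap_lpResolventLM hl y⟩

omit [CompleteSpace E] in
/-- `(λ − A)⁻¹(λx − Ax) = x` for `x ∈ D(A)`. [cite: EngelNagel2000, Ch. II Thm. 3.15] -/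
theorem lpResolvent_sub_apply (h : IsLumerPhillipsData A) {l : ℝ} (hl : 0 < l) (x : A.domain) :
    h.lpResolvent hl ((l : ℂ) • (x : E) - A x) = x :=
  h.lpResolventLM_subMap hl x

omit [CompleteSpace E] in
/-- **The resolvent identity** `R_λ y − R_μ y = (μ − λ)·R_λ(R_μ y)` for real `λ, μ > 0`.
[cite: EngelNagel2000, Ch. II Thm. 3.15] -/
theorem lpResolvent_sub (h : IsLumerPhillipsData A) {l m : ℝ} (hl : 0 < l) (hm : 0 < m) (y : E) :
    h.lpResolvent hl y - h.lpResolvent hm y = ((m : ℂ) - l) • h.lpResolvent hl (h.lpResolvent hm y) := by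
  obtain ⟨hx, hxeq⟩ := h.sub_apply_lpResolvent hm y
  set x : A.domain := ⟨h.lpResolvent hm y, hx⟩ with hxdef
  -- `y = (l − A)x + (m − l)x`
  have hy : y = ((l : ℂ) • (x : E) - A x) + ((m : ℂ) - l) • (x : E) := by
    rw [← hxeq]; simp only [hxdef]; rw [sub_smul]; abel
  have h1 : h.lpResolvent hl y = (x : E) + ((m : ℂ) - l) • h.lpResolvent hl (x : E) := by
    conv_lhs => rw [hy]
    rw [map_add, map_smul, h.lpResolvent_sub_apply hl x]
  rw [h1]
  simp only [hxdef]
  abel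

/-! ### The pseudo-resolvent on the positive real axis and its Hille–Yosida data -/

/-- The resolvent family on `ℂ`: `(Re z − A)⁻¹` for `Re z > 0`, junk `0` otherwise (only the points of the
positive real axis are used). [cite: EngelNagel2000, Ch. II Thm. 3.15] -/
def lpFamily (h : IsLumerPhillipsData A) (z : ℂ) : E →L[ℂ] E :=
  if hz : 0 < z.re then h.lpResolvent hz else 0

omit [CompleteSpace E] in
/-- On a real `λ > 0` the family is `(λ − A)⁻¹`. [cite: EngelNagel2000, Ch. II Thm. 3.15] -/
theorem lpFamily_ofReal (h : IsLumerPhillipsData A) {l : ℝ} (hl : 0 < l) : h.lpFamily l = h.lpResolvent hl := by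
  have hl' : 0 < (l : ℂ).re := by simpa using hl
  rw [lpFamily, dif_pos hl']

omit [CompleteSpace E] in
/-- **Pseudo-resolvent** on the positive real axis `U = {z : Im z = 0, Re z > 0}`. [cite: EngelNagel2000, Ch. II Thm. 3.15] -/
theorem isPseudoResolvent_lpFamily (h : IsLumerPhillipsData A) :
    IsPseudoResolvent {z : ℂ | z.im = 0 ∧ 0 < z.re} h.lpFamily := by
  intro z hz w hw
  obtain ⟨hzi, hzr⟩ := hz
  obtain ⟨hwi, hwr⟩ := hw
  have hz' : z = (z.re : ℂ) := by apply Complex.ext <;> simp [hzi]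
  have hw' : w = (w.re : ℂ) := by apply Complex.ext <;> simp [hwi]
  rw [hz', hw', h.lpFamily_ofReal hzr, h.lpFamily_ofReal hwr]
  ext y
  rw [sub_apply, h.lpResolvent_sub hzr hwr y, smul_apply, mul_apply_eq_comp]

omit [CompleteSpace E] in
/-- **Hille–Yosida data** for the family `(λ − A)⁻¹`. [cite: EngelNagel2000, Ch. II Thm. 3.15] -/
theorem isHilleYosidaData_lpFamily (h : IsLumerPhillipsData A) : IsHilleYosidaData {z : ℂ | z.im = 0 ∧ 0 < z.re} h.lpFamily where
  pseudo := h.isPseudoResolvent_lpFamily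
  mem l hl := by simpa using hl
  norm_le l hl := by rw [h.lpFamily_ofReal hl]; exact h.norm_lpResolvent_le hl
  dense := by
    have h1 : h.lpFamily 1 = h.lpResolvent one_pos := by simpa using h.lpFamily_ofReal one_pos
    refine h.dense.mono fun x hx => ?_
    refine ⟨(1 : ℂ) • x - A ⟨x, hx⟩, ?_⟩
    rw [h1]
    exact h.lpResolvent_sub_apply one_pos ⟨x, hx⟩

/-! ### The generation theorem -/

omit [CompleteSpace E] in
/-- The closed operator of the family `(λ − A)⁻¹` at `1` IS `A`. [cite: EngelNagel2000, Ch. II Thm. 3.15] -/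
theorem operatorOfResolvent_lpFamily (h : IsLumerPhillipsData A) (hinj : Function.Injective (h.lpFamily 1)) :
    operatorOfResolvent h.lpFamily 1 hinj = A := by
  have h1 : h.lpFamily 1 = h.lpResolvent one_pos := by simpa using h.lpFamily_ofReal one_pos
  apply LinearPMap.eq_of_eq_graph
  ext p
  rw [mem_graph_operatorOfResolvent_iff, LinearPMap.mem_graph_iff, h1, one_smul]
  constructor
  · intro hp
    obtain ⟨hy, hyeq⟩ := h.sub_apply_lpResolvent one_pos (p.1 - p.2)
    rw [Complex.ofReal_one, one_smul] at hyeq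
    have hmem : p.1 ∈ A.domain := by rw [← hp]; exact hy
    refine ⟨⟨p.1, hmem⟩, rfl, ?_⟩
    have heq : (⟨h.lpResolvent one_pos (p.1 - p.2), hy⟩ : A.domain) = ⟨p.1, hmem⟩ := Subtype.ext hp
    rw [heq, hp] at hyeq
    -- `p.1 − A p.1 = p.1 − p.2`
    have := sub_right_injective (show p.1 - A ⟨p.1, hmem⟩ = p.1 - p.2 from hyeq)
    exact this
  · rintro ⟨x, hx1, hx2⟩
    rw [← hx1, ← hx2]
    have := h.lpResolvent_sub_apply one_pos x
    rwa [Complex.ofReal_one, one_smul] at this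

/-- **LUMER–PHILLIPS (Engel–Nagel II Thm. 3.15).** A densely defined operator `A` on a complex Banach
space which is dissipative (`λ‖x‖ ≤ ‖λx − Ax‖`, `λ > 0`) and satisfies the range condition (`λ − A` onto
for `λ > 0`) generates a contraction C₀-semigroup: there is `T : C0Semigroup ℂ E` with `‖T(t)‖ ≤ 1` and
`T.generator = A`; its Laplace transform at real `λ > 0` is `(λ − A)⁻¹`. (Unique by
`C0Semigroup.eq_of_generator_eq`.) [cite: EngelNagel2000, Ch. II Thm. 3.15] -/
theorem exists_c0Semigroup (h : IsLumerPhillipsData A) :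
    ∃ T : C0Semigroup ℂ E, T.IsContraction ∧
      (∀ l : ℝ, ∀ hl : 0 < l, ∀ x : E, T.laplaceResolventFun l x = h.lpResolvent hl x) ∧ T.generator = A := by
  have hHY := h.isHilleYosidaData_lpFamily
  obtain ⟨T, hT, hlap, hgen⟩ := hHY.exists_c0Semigroup
  refine ⟨T, hT, fun l hl x => ?_, ?_⟩
  · have := hlap l (by simpa using hl) (by simpa using hl) x
    rw [this, h.lpFamily_ofReal hl]
  · rw [hgen, h.operatorOfResolvent_lpFamily]

end IsLumerPhillipsData

end HilleYosida

end Literature.Analysis.UnboundedOperators
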